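import Literature.Algebra.EuclideanLattices.KhotExplicitReduction
import Literature.Computability.Complexity.AOWListMatrix
import HarnessLib

/-!
# Khot 2005, §3–5 at list level: the base basis `B₀` and the sampled shift as tables

Topic `Algebra/EuclideanLattices`, namespace `Literature.Algebra.EuclideanLattices.Khot`. Support file
for the machine hypothesis of `gapSVP_const_isNPHardRandomized_of_prop6_of_FP_explicit`
(`KhotExplicitReduction.lean`). The base basis of Khot's reduction is
`B₀ = finBasis (intBasis Q F P s') (liftRow r) D q` (`KhotAssembly.baseBasis`; Thm. 3.1 Fig. 1, §4
Fig. 2, §5.1 Fig. 3, §5.2.2 Fig. 4): a block matrix over the row type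
`RowsT ⊕ Unit = ((U ⊕ S) ⊕ (H ⊕ Nn)) ⊕ Unit` and the column type
`ColsT = ((S ⊕ (Nn ⊕ H)) ⊕ Unit) ⊕ Unit`. This file writes its entries as a FUNCTIONAL PROGRAM
(`intEnt`, `baseEnt`, `baseTab`) on the list data a machine holds — the sets as lists of naturals,
the BCH block as a list matrix (`KhotBCHTableFP.khotBCHTab`), the shift `s'` and the lifted random row
`r` as lists — in the row order `rowsUnitEquivFin` (`idxR`: universe, sets, BCH rows `b + (M+1)a`,
columns, extra row) and the column order `colsEquivFin` (sets, columns, BCH rows, target, extra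
column) of `khotDataExplicit`, and proves it correct (`ent_baseTab`). It also writes the sampled shift
`tupleShift P g` (Lemma 4.3) as the list program `shiftL` (`getD_shiftL`). No machines, no facts.

## References

* S. Khot, *Hardness of approximating the shortest vector problem in lattices*, J. ACM 52 (2005)
  789–808, Thm. 3.1 (Fig. 1), §4 (Fig. 2), Lemma 4.3, §5.1 (Fig. 3), §5.2.2 (Fig. 4).
* S. Arora, B. Barak, *Computational Complexity: A Modern Approach*, CUP 2009, §1.3.
-/

namespace Literature.Algebra.EuclideanLattices.Khot

open Literature.Computability.Complexity Literature.Computability.Complexity.LMat Finset Matrix Params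

/-! ### The programs -/

section Programs

/-- **Entries of the intermediate basis `B_int`** (§5.1, Fig. 3) on the row ranges
`[0,u)` universe, `[u,u+σ)` sets, `[u+σ,u+σ+h)` BCH rows, `[u+σ+h, u+σ+h+N)` columns and the column
ranges `[0,σ)` sets, `[σ,σ+N)` columns, `[σ+N,σ+N+h)` BCH rows, `σ+N+h` target:
`2Q[e ∈ S_j]`, `2I`, `Q·P`, `2Q·I`, `I`, and the target column `2Q` (universe) / `Q·s'` (BCH rows).
[cite: Khot2005, §5.1 (Fig. 3)] -/
def intEnt (u σ h N : ℕ) (sets : List (List ℕ)) (Ptab : List (List ℤ)) (sL : List ℤ) (Q : ℤ) (i j : ℕ) : ℤ :=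
  if i < u then
    if j < σ then (if i ∈ sets.getD j [] then 2 * Q else 0)
    else if j = σ + N + h then 2 * Q else 0
  else if i < u + σ then
    if j < σ then (if i - u = j then 2 else 0) else 0
  else if i < u + σ + h then
    if j < σ then 0
    else if j < σ + N then Q * ent Ptab (i - (u + σ)) (j - σ)
    else if j < σ + N + h then (if i - (u + σ) = j - (σ + N) then 2 * Q else 0)
    else if j = σ + N + h then Q * sL.getD (i - (u + σ)) 0 else 0
  else
    if σ ≤ j ∧ j < σ + N then (if i - (u + σ + h) = j - σ then 1 else 0) else 0

/-- **Entries of the base basis `B₀ = [[B_int, 0],[D·r B_int, D·q]]`** (§5.2.2, Fig. 4) on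
`(ρ+1) × cσ`, `ρ = u+σ+h+N`, `cσ = σ+N+h+2`; the range `ρ` of the sum in the last row is a separate
argument (a machine holds it in unary). [cite: Khot2005, §5.2.2 (Fig. 4)] -/
def baseEnt (ρ u σ h N : ℕ) (sets : List (List ℕ)) (Ptab : List (List ℤ)) (sL : List ℤ) (Q D q : ℤ)
    (rL : List ℤ) (i j : ℕ) : ℤ :=
  if i < u + σ + h + N then
    if j < σ + N + h + 1 then intEnt u σ h N sets Ptab sL Q i j else 0
  else if j < σ + N + h + 1 then
    D * sumRange ρ fun i' => rL.getD i' 0 * intEnt u σ h N sets Ptab sL Q i' j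
  else D * q

/-- **The base basis as a table.** [cite: Khot2005, §5.2.2 (Fig. 4)] -/
def baseTab (u σ h N : ℕ) (sets : List (List ℕ)) (Ptab : List (List ℤ)) (sL : List ℤ) (Q D q : ℤ)
    (rL : List ℤ) : List (List ℤ) :=
  tab (u + σ + h + N + 1) (σ + N + h + 1 + 1) (baseEnt (u + σ + h + N) u σ h N sets Ptab sL Q D q rL)

/-- **The sampled shift as a list** (Lemma 4.3: "pick `r` columns of `P_BCH` … and define `s` to be
their sum" over `GF(2)`): row `hr` carries `(∑_{nc < N, nc ∈ g} P hr nc) mod 2`, the columns listed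
(with repetitions) in `gL`. [cite: Khot2005, Lemma 4.3 (proof)] -/
def shiftL (h N : ℕ) (Ptab : List (List ℤ)) (gL : List ℕ) : List ℤ :=
  (List.range h).map fun hr => (sumRange N fun nc => if nc ∈ gL then ent Ptab hr nc else 0) % 2

end Programs

/-! ### Values of the base enumerations -/

section EquivValues

variable (u σ K k : ℕ)

/-- Universe rows: `idxR (e) = e`. [folklore] -/
theorem idxR_inl_inl (e : Fin u) : (idxR u σ K k (Sum.inl (Sum.inl e)) : ℕ) = e := by
  simp [idxR]

/-- Set rows: `idxR (j) = u + j`. [folklore] -/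
theorem idxR_inl_inr (j : Fin σ) : (idxR u σ K k (Sum.inl (Sum.inr j)) : ℕ) = u + j := by
  simp [idxR]

/-- BCH rows: `idxR (a, b) = u + σ + (b + (M+1)·a)`. [folklore] -/
theorem idxR_inr_inl (a : Fin (20 * K)) (b : Fin (MM u σ K k + 1)) :
    (idxR u σ K k (Sum.inr (Sum.inl (a, b))) : ℕ) = u + σ + (b + (MM u σ K k + 1) * a) := by
  simp [idxR]

/-- Column rows: `idxR (nc) = u + σ + h + nc`. [folklore] -/
theorem idxR_inr_inr (nc : Fin (NN u σ K k)) :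
    (idxR u σ K k (Sum.inr (Sum.inr nc)) : ℕ) = u + σ + hh u σ K k + nc := by
  simp [idxR, hh]; ring

/-- `rowsUnitEquivFin (inl x) = idxR x`. [folklore] -/
theorem rowsUnitEquivFin_inl (x : RowsT u σ K k) : (rowsUnitEquivFin u σ K k (Sum.inl x) : ℕ) = idxR u σ K k x := by
  simp [rowsUnitEquivFin]

/-- The extra row is last: `rowsUnitEquivFin (inr ()) = rows`. [folklore] -/
theorem rowsUnitEquivFin_inr (t : Unit) : (rowsUnitEquivFin u σ K k (Sum.inr t) : ℕ) = rows u σ K k := by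
  simp [rowsUnitEquivFin]

/-- Set columns: `colsEquivFin (j) = j`. [folklore] -/
theorem colsEquivFin_set (j : Fin σ) : (colsEquivFin u σ K k (Sum.inl (Sum.inl (Sum.inl j))) : ℕ) = j := by
  show ((finSumFinEquiv (Sum.inl (finSumFinEquiv (Sum.inl (finSumFinEquiv (Sum.inl j))))) :
    Fin (σ + (NN u σ K k + hh u σ K k) + 1 + 1)) : ℕ) = _
  rw [finSumFinEquiv_apply_left, Fin.val_castAdd, finSumFinEquiv_apply_left, Fin.val_castAdd,
    finSumFinEquiv_apply_left, Fin.val_castAdd]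

/-- Column columns: `colsEquivFin (nc) = σ + nc`. [folklore] -/
theorem colsEquivFin_col (nc : Fin (NN u σ K k)) :
    (colsEquivFin u σ K k (Sum.inl (Sum.inl (Sum.inr (Sum.inl nc)))) : ℕ) = σ + nc := by
  show ((finSumFinEquiv (Sum.inl (finSumFinEquiv (Sum.inl (finSumFinEquiv (Sum.inr (finSumFinEquiv (Sum.inl nc))))))) :
    Fin (σ + (NN u σ K k + hh u σ K k) + 1 + 1)) : ℕ) = _
  rw [finSumFinEquiv_apply_left, Fin.val_castAdd, finSumFinEquiv_apply_left, Fin.val_castAdd,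
    finSumFinEquiv_apply_right, Fin.val_natAdd, finSumFinEquiv_apply_left, Fin.val_castAdd]

/-- BCH columns: `colsEquivFin (a, b) = σ + N + (b + (M+1)·a)`. [folklore] -/
theorem colsEquivFin_bch (a : Fin (20 * K)) (b : Fin (MM u σ K k + 1)) :
    (colsEquivFin u σ K k (Sum.inl (Sum.inl (Sum.inr (Sum.inr (a, b))))) : ℕ) =
      σ + NN u σ K k + (b + (MM u σ K k + 1) * a) := by
  show ((finSumFinEquiv (Sum.inl (finSumFinEquiv (Sum.inl (finSumFinEquiv (Sum.inr (finSumFinEquiv (Sum.inr (Fin.cast (by unfold hh; ring) (finProdFinEquiv (a, b)))))))))) :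
    Fin (σ + (NN u σ K k + hh u σ K k) + 1 + 1)) : ℕ) = _
  rw [finSumFinEquiv_apply_left, Fin.val_castAdd, finSumFinEquiv_apply_left, Fin.val_castAdd,
    finSumFinEquiv_apply_right, Fin.val_natAdd, finSumFinEquiv_apply_right, Fin.val_natAdd, Fin.val_cast,
    finProdFinEquiv_apply_val]
  simp only []
  omega

/-- The target column: `colsEquivFin (target) = σ + N + h`. [folklore] -/
theorem colsEquivFin_target (t : Unit) :
    (colsEquivFin u σ K k (Sum.inl (Sum.inr t)) : ℕ) = σ + NN u σ K k + hh u σ K k := by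
  show ((finSumFinEquiv (Sum.inl (finSumFinEquiv (Sum.inr (finOneEquiv.symm t)))) :
    Fin (σ + (NN u σ K k + hh u σ K k) + 1 + 1)) : ℕ) = _
  rw [finSumFinEquiv_apply_left, Fin.val_castAdd, finSumFinEquiv_apply_right, Fin.val_natAdd, Fin.val_eq_zero,
    Nat.add_zero]
  omega

/-- The extra column is last: `colsEquivFin (extra) = σ + N + h + 1`. [folklore] -/
theorem colsEquivFin_extra (t : Unit) :
    (colsEquivFin u σ K k (Sum.inr t) : ℕ) = σ + NN u σ K k + hh u σ K k + 1 := by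
  show ((finSumFinEquiv (Sum.inr (finOneEquiv.symm t)) :
    Fin (σ + (NN u σ K k + hh u σ K k) + 1 + 1)) : ℕ) = _
  rw [finSumFinEquiv_apply_right, Fin.val_natAdd, Fin.val_eq_zero, Nat.add_zero]
  omega

end EquivValues

/-! ### Correctness of the programs -/

section Correct

variable {u σ K k : ℕ}

/-- The flattened BCH index `b + (M+1)a` is below `h = 20K(M+1)`. [folklore] -/
theorem bch_index_lt (a : Fin (20 * K)) (b : Fin (MM u σ K k + 1)) : (b : ℕ) + (MM u σ K k + 1) * a < (hh u σ K k) := by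
  have ha := a.isLt
  unfold hh
  calc (b : ℕ) + (MM u σ K k + 1) * a < (MM u σ K k + 1) + (MM u σ K k + 1) * a := by omega
    _ = (MM u σ K k + 1) * (a + 1) := by ring
    _ ≤ (MM u σ K k + 1) * (20 * K) := Nat.mul_le_mul_left _ ha
    _ = 20 * K * (MM u σ K k + 1) := by ring

/-- **`shiftL` is the sampled shift**: with `Ptab` holding `P` (rows `b + (M+1)a`) and `gL` the list
of sampled columns, entry `b + (M+1)a` of `shiftL` is `tupleShift P g (a, b)`. [cite: Khot2005, Lemma 4.3 (proof)] -/
theorem getD_shiftL {P : Matrix (Fin (20 * K) × Fin (MM u σ K k + 1)) (Fin (NN u σ K k)) ℤ} {Ptab : List (List ℤ)}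
    (hP : ∀ (a : Fin (20 * K)) (b : Fin (MM u σ K k + 1)) (nc : Fin (NN u σ K k)),
      ent Ptab ((b : ℕ) + (MM u σ K k + 1) * a) nc = P (a, b) nc) {rr : ℕ} (g : Fin rr → Fin (NN u σ K k))
    {gL : List ℕ} (hg : ∀ nc : Fin (NN u σ K k), (nc : ℕ) ∈ gL ↔ ∃ i, g i = nc) (a : Fin (20 * K)) (b : Fin (MM u σ K k + 1)) :
    (shiftL (hh u σ K k) (NN u σ K k) Ptab gL).getD ((b : ℕ) + (MM u σ K k + 1) * a) 0 = tupleShift P g (a, b) := by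
  have hlt : (b : ℕ) + (MM u σ K k + 1) * a < (hh u σ K k) := bch_index_lt a b
  unfold shiftL
  rw [getD_map_range _ hlt, tupleShift, sumRange_eq_sum]
  congr 1
  simp only [Matrix.mulVec, dotProduct, indicator]
  refine Finset.sum_congr rfl fun nc _ => ?_
  rw [hP]
  by_cases h : nc ∈ (univ : Finset (Fin rr)).image g
  · rw [if_pos h, mul_one, if_pos]
    obtain ⟨i, -, hi⟩ := Finset.mem_image.1 h
    exact (hg nc).2 ⟨i, hi⟩
  · rw [if_neg h, mul_zero, if_neg]
    intro hmem
    obtain ⟨i, hi⟩ := (hg nc).1 hmem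
    exact h (Finset.mem_image.2 ⟨i, Finset.mem_univ _, hi⟩)

variable {sets : List (List ℕ)} {F : Fin σ → Finset (Fin u)}
  {P : Matrix (Fin (20 * K) × Fin (MM u σ K k + 1)) (Fin (NN u σ K k)) ℤ} {Ptab : List (List ℤ)}
  {s' : Fin (20 * K) × Fin (MM u σ K k + 1) → ℤ} {sL : List ℤ} {Q : ℤ}

/-- **`intEnt` is the intermediate basis**: through `idxR` and the column order of `colsEquivFin`,
`intEnt` holds `intBasis Q F P s'`, provided the sets, the BCH block and the shift are held by
`sets`, `Ptab`, `sL`. [cite: Khot2005, §5.1 (Fig. 3)] -/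
theorem intEnt_eq (hF : ∀ j e, e ∈ F j ↔ (e : ℕ) ∈ sets.getD j [])
    (hP : ∀ (a : Fin (20 * K)) (b : Fin (MM u σ K k + 1)) (nc : Fin (NN u σ K k)),
      ent Ptab ((b : ℕ) + (MM u σ K k + 1) * a) nc = P (a, b) nc)
    (hs : ∀ (a : Fin (20 * K)) (b : Fin (MM u σ K k + 1)), sL.getD ((b : ℕ) + (MM u σ K k + 1) * a) 0 = s' (a, b))
    (x : RowsT u σ K k) (cI : (Fin σ ⊕ (Fin (NN u σ K k) ⊕ (Fin (20 * K) × Fin (MM u σ K k + 1)))) ⊕ Unit) :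
    intEnt u σ (hh u σ K k) (NN u σ K k) sets Ptab sL Q (idxR u σ K k x) (colsEquivFin u σ K k (Sum.inl cI)) = intBasis Q F P s' x cI := by
  have hbch : ∀ (a : Fin (20 * K)) (b : Fin (MM u σ K k + 1)), (b : ℕ) + (MM u σ K k + 1) * a < (hh u σ K k) :=
    bch_index_lt
  have hinj : ∀ (a a' : Fin (20 * K)) (b b' : Fin (MM u σ K k + 1)),
      ((b : ℕ) + (MM u σ K k + 1) * a = b' + (MM u σ K k + 1) * a') ↔ (a, b) = (a', b') := fun a a' b b' => by
    constructor
    · intro h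
      have h1 : (finProdFinEquiv (a, b) : ℕ) = finProdFinEquiv (a', b') := by
        rw [finProdFinEquiv_apply_val, finProdFinEquiv_apply_val]; exact h
      exact finProdFinEquiv.injective (Fin.ext h1)
    · intro h; cases h; rfl
  rcases x with (e | j') | (⟨a, b⟩ | nr) <;> rcases cI with ((j | (nc | ⟨a', b'⟩)) | t)
  -- universe rows
  · rw [idxR_inl_inl, colsEquivFin_set]
    have he := e.isLt; have hj := j.isLt
    simp only [intEnt, if_pos he, if_pos hj, intBasis, cvpBasis, incidence, Matrix.fromCols_apply_inl,
      Matrix.fromBlocks_apply₁₁, Matrix.smul_apply, Matrix.fromRows_apply_inl, Matrix.of_apply, smul_eq_mul, hF j e]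
    split_ifs <;> simp [mul_comm]
  · rw [idxR_inl_inl, colsEquivFin_col]
    have he := e.isLt
    simp only [intEnt, if_pos he, intBasis, Matrix.fromCols_apply_inl, Matrix.fromBlocks_apply₁₂, Matrix.zero_apply]
    rw [if_neg (by omega), if_neg (by omega)]
  · rw [idxR_inl_inl, colsEquivFin_bch]
    have he := e.isLt; have hb := hbch a' b'
    simp only [intEnt, if_pos he, intBasis, Matrix.fromCols_apply_inl, Matrix.fromBlocks_apply₁₂, Matrix.zero_apply]
    rw [if_neg (by omega), if_neg (by omega)]
  · rw [idxR_inl_inl, colsEquivFin_target]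
    have he := e.isLt
    simp only [intEnt, if_pos he, intBasis, cvpTarget, Matrix.fromCols_apply_inr, Matrix.of_apply, Sum.elim_inl,
      Pi.smul_apply, smul_eq_mul]
    rw [if_neg (by omega)]
    simp
  -- set rows
  · rw [idxR_inl_inr, colsEquivFin_set]
    have hj := j.isLt; have hj' := j'.isLt
    simp only [intEnt, intBasis, cvpBasis, Matrix.fromCols_apply_inl, Matrix.fromBlocks_apply₁₁, Matrix.smul_apply,
      Matrix.fromRows_apply_inr, Matrix.one_apply, smul_eq_mul, Fin.ext_iff]
    rw [if_neg (by omega), if_pos (by omega), if_pos hj, Nat.add_sub_cancel_left]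
    split_ifs <;> simp
  · rw [idxR_inl_inr, colsEquivFin_col]
    have hj' := j'.isLt
    simp only [intEnt, intBasis, Matrix.fromCols_apply_inl, Matrix.fromBlocks_apply₁₂, Matrix.zero_apply]
    rw [if_neg (by omega), if_pos (by omega), if_neg (by omega)]
  · rw [idxR_inl_inr, colsEquivFin_bch]
    have hj' := j'.isLt
    simp only [intEnt, intBasis, Matrix.fromCols_apply_inl, Matrix.fromBlocks_apply₁₂, Matrix.zero_apply]
    rw [if_neg (by omega), if_pos (by omega), if_neg (by omega)]
  · rw [idxR_inl_inr, colsEquivFin_target]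
    have hj' := j'.isLt
    simp only [intEnt, intBasis, cvpTarget, Matrix.fromCols_apply_inr, Matrix.of_apply, Sum.elim_inl, Pi.smul_apply,
      smul_eq_mul, Pi.zero_apply, Sum.elim_inr]
    rw [if_neg (by omega), if_pos (by omega), if_neg (by omega)]
    simp
  -- BCH rows
  · rw [idxR_inr_inl, colsEquivFin_set]
    have hb := hbch a b; have hj := j.isLt
    simp only [intEnt, intBasis, Matrix.fromCols_apply_inl, Matrix.fromBlocks_apply₂₁, Matrix.zero_apply]
    rw [if_neg (by omega), if_neg (by omega), if_pos (by omega), if_pos hj]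
  · rw [idxR_inr_inl, colsEquivFin_col]
    have hb := hbch a b; have hnc := nc.isLt
    simp only [intEnt, intBasis, bchBasis, Matrix.fromCols_apply_inl, Matrix.fromBlocks_apply₂₂, Matrix.fromBlocks_apply₁₁,
      Matrix.smul_apply, smul_eq_mul]
    rw [if_neg (by omega), if_neg (by omega), if_pos (by omega), if_neg (by omega), if_pos (by omega),
      Nat.add_sub_cancel_left, Nat.add_sub_cancel_left, hP]
  · rw [idxR_inr_inl, colsEquivFin_bch]
    have hb := hbch a b; have hb' := hbch a' b'
    simp only [intEnt, intBasis, bchBasis, Matrix.fromCols_apply_inl, Matrix.fromBlocks_apply₂₂, Matrix.fromBlocks_apply₁₂,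
      Matrix.smul_apply, Matrix.one_apply, smul_eq_mul]
    rw [if_neg (by omega), if_neg (by omega), if_pos (by omega), if_neg (by omega), if_neg (by omega), if_pos (by omega),
      Nat.add_sub_cancel_left, Nat.add_sub_cancel_left]
    simp only [hinj]
    split_ifs <;> simp
  · rw [idxR_inr_inl, colsEquivFin_target]
    have hb := hbch a b
    simp only [intEnt, intBasis, bchShift, Matrix.fromCols_apply_inr, Matrix.of_apply, Sum.elim_inr, Sum.elim_inl,
      Pi.smul_apply, smul_eq_mul]
    rw [if_neg (by omega), if_neg (by omega), if_pos (by omega), if_neg (by omega), if_neg (by omega), if_neg (by omega),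
      Nat.add_sub_cancel_left, hs]
    simp
  -- column rows
  · rw [idxR_inr_inr, colsEquivFin_set]
    have hj := j.isLt
    simp only [intEnt, intBasis, Matrix.fromCols_apply_inl, Matrix.fromBlocks_apply₂₁, Matrix.zero_apply]
    rw [if_neg (by omega), if_neg (by omega), if_neg (by omega), if_neg (by omega)]
  · rw [idxR_inr_inr, colsEquivFin_col]
    have hnc := nc.isLt; have hnr := nr.isLt
    simp only [intEnt, intBasis, bchBasis, Matrix.fromCols_apply_inl, Matrix.fromBlocks_apply₂₂, Matrix.fromBlocks_apply₂₁,
      Matrix.one_apply, Fin.ext_iff]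
    rw [if_neg (by omega), if_neg (by omega), if_neg (by omega), if_pos (by omega), Nat.add_sub_cancel_left,
      Nat.add_sub_cancel_left]
  · rw [idxR_inr_inr, colsEquivFin_bch]
    have hb' := hbch a' b'; have hnr := nr.isLt
    simp only [intEnt, intBasis, bchBasis, Matrix.fromCols_apply_inl, Matrix.fromBlocks_apply₂₂, Matrix.fromBlocks_apply₂₂,
      Matrix.zero_apply]
    rw [if_neg (by omega), if_neg (by omega), if_neg (by omega), if_neg (by omega)]
  · rw [idxR_inr_inr, colsEquivFin_target]
    have hnr := nr.isLt
    simp only [intEnt, intBasis, bchShift, Matrix.fromCols_apply_inr, Matrix.of_apply, Sum.elim_inr, Pi.zero_apply]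
    rw [if_neg (by omega), if_neg (by omega), if_neg (by omega), if_neg (by omega)]

variable {D : ℤ} {q : ℕ} {r : RowsT u σ K k → ZMod q} {rL : List ℤ}

/-- **`baseTab` is the base basis**: through `rowsUnitEquivFin`/`colsEquivFin`, the entries of
`baseTab` are those of `baseBasis Q F P s' (liftRow r) D q`, provided the data are held by the lists.
[cite: Khot2005, §5.2.2 (Fig. 4)] -/
theorem ent_baseTab (hF : ∀ j e, e ∈ F j ↔ (e : ℕ) ∈ sets.getD j [])
    (hP : ∀ (a : Fin (20 * K)) (b : Fin (MM u σ K k + 1)) (nc : Fin (NN u σ K k)),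
      ent Ptab ((b : ℕ) + (MM u σ K k + 1) * a) nc = P (a, b) nc)
    (hs : ∀ (a : Fin (20 * K)) (b : Fin (MM u σ K k + 1)), sL.getD ((b : ℕ) + (MM u σ K k + 1) * a) 0 = s' (a, b))
    (hr : ∀ x, rL.getD (idxR u σ K k x) 0 = ((r x).val : ℤ))
    (p : RowsT u σ K k ⊕ Unit) (i : ColsT u σ K k) :
    ent (baseTab u σ (hh u σ K k) (NN u σ K k) sets Ptab sL Q D q rL) (rowsUnitEquivFin u σ K k p) (colsEquivFin u σ K k i) =
      baseBasis Q F P s' (liftRow r) D q p i := by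
  have hρ : u + σ + (hh u σ K k) + (NN u σ K k) = rows u σ K k := rfl
  have hrow := (rowsUnitEquivFin u σ K k p).isLt
  have hcol := (colsEquivFin u σ K k i).isLt
  unfold baseTab
  rw [ent_tab _ (by rw [hρ]; exact hrow) (by unfold cols at hcol; omega), baseEnt]
  rcases p with x | t <;> rcases i with cI | t'
  · have hx := (idxR u σ K k x).isLt
    have hc : (colsEquivFin u σ K k (Sum.inl cI) : ℕ) < σ + (NN u σ K k) + (hh u σ K k) + 1 := by
      rcases cI with ((j | (nc | ⟨a', b'⟩)) | t)
      · rw [colsEquivFin_set]; omega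
      · rw [colsEquivFin_col]; omega
      · rw [colsEquivFin_bch]
        have : (b' : ℕ) + (MM u σ K k + 1) * a' < (hh u σ K k) := bch_index_lt a' b'
        omega
      · rw [colsEquivFin_target]; omega
    rw [rowsUnitEquivFin_inl, if_pos (by rw [hρ]; exact hx), if_pos hc, intEnt_eq hF hP hs, baseBasis, finBasis,
      Matrix.fromBlocks_apply₁₁]
  · rw [rowsUnitEquivFin_inl, colsEquivFin_extra, if_pos (by rw [hρ]; exact (idxR u σ K k x).isLt), if_neg (by omega),
      baseBasis, finBasis, Matrix.fromBlocks_apply₁₂, Matrix.zero_apply]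
  · have hc : (colsEquivFin u σ K k (Sum.inl cI) : ℕ) < σ + (NN u σ K k) + (hh u σ K k) + 1 := by
      rcases cI with ((j | (nc | ⟨a', b'⟩)) | t)
      · rw [colsEquivFin_set]; omega
      · rw [colsEquivFin_col]; omega
      · rw [colsEquivFin_bch]
        have : (b' : ℕ) + (MM u σ K k + 1) * a' < (hh u σ K k) := bch_index_lt a' b'
        omega
      · rw [colsEquivFin_target]; omega
    rw [rowsUnitEquivFin_inr, if_neg (by rw [hρ]; exact lt_irrefl _), if_pos hc, baseBasis, finBasis,
      Matrix.fromBlocks_apply₂₁, Matrix.of_apply, sumRange_eq_sum]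
    congr 1
    simp only [Matrix.vecMul, dotProduct, liftRow]
    rw [hρ, ← (idxR u σ K k).sum_comp]
    exact Finset.sum_congr rfl fun x _ => by rw [hr, intEnt_eq hF hP hs]
  · rw [rowsUnitEquivFin_inr, colsEquivFin_extra, if_neg (by rw [hρ]; exact lt_irrefl _), if_neg (by omega),
      baseBasis, finBasis, Matrix.fromBlocks_apply₂₂, Matrix.of_apply]

end Correct

end Literature.Algebra.EuclideanLattices.Khot
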